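import Mathlib
import HarnessLib

-- provenance: harness21/H21/H21/Statements/Lang/Wave0.lean @ 74deab0 (interim HEAD d8f2665); M5 mechanical rewrite
/-!
# Langlands family (`lang`), wave 0: modularity of elliptic curves and adelic compactness

This file states the two targets of the `lang` family of the H21 gap inventory
(2026-08-12) that are statable on top of Mathlib alone.

* **lang.S33** (covered): modularity of elliptic curves over `ℚ` in the weak
  `a_p`-matching form: for every elliptic curve `E/ℚ` there are `N ≥ 1` and a cusp form
  `f ∈ S₂(Γ₀(N))` with `a_p(f) = p + 1 - #E(𝔽_p)` for every prime `p ∤ N Δ_E`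
  (Wiles 1995; Taylor–Wiles 1995; Breuil–Conrad–Diamond–Taylor, JAMS 14 (2001), Thm A).
  We also record the (equally known) sharper variant matching *all* `q`-expansion
  coefficients with the coefficients of Mathlib's `WeierstrassCurve.LFunction`.
* **lang.S38** (covered): the adele ring `𝔸_K` of a number field is locally compact, `K` is
  discrete and cocompact in `𝔸_K`, and the norm-one idele class group `𝔸_Kˣ,¹ / Kˣ` is
  compact (Cassels–Fröhlich, *Algebraic Number Theory*, Ch. II §§14–17; Weil, *Basic Number
  Theory*, Ch. IV).

No statement of the inventory marked `statable_today` is skipped.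

## Design choices

* For **lang.S33** the elliptic curve is given by an *integral* Weierstrass model
  `E : WeierstrassCurve ℤ` with `E.Δ ≠ 0` (every elliptic curve over `ℚ` has one), so that
  "`p ∤ Δ_E`" and "reduction mod `p`" make sense literally: the reduction is
  `E.map (Int.castRingHom (ZMod p))` and `#E(𝔽_p)` is `Nat.card` of its type of points
  (`WeierstrassCurve.Affine.Point`, which includes the point at infinity). Cusp forms of level
  `Γ₀(N)` and weight `2` are `CuspForm (CongruenceSubgroup.Gamma0 N) 2` (via Mathlib's coercion
  `Subgroup SL(2, ℤ) → Subgroup (GL (Fin 2) ℝ)`), and `a_n(f)` is the `n`-th coefficient of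
  `UpperHalfPlane.qExpansion 1 f` (the cusp `∞` of `Γ₀(N)` has strict width `1`,
  `CongruenceSubgroup.strictWidthInfty_Gamma0`).
* For **lang.S38** the adele ring is `NumberField.AdeleRing (𝓞 K) K` and the principal adeles
  are `NumberField.AdeleRing.principalSubgroup (𝓞 K) K` (both Mathlib). The ideles are the units
  `(AdeleRing (𝓞 K) K)ˣ` with Mathlib's units topology `Units.instTopologicalSpaceUnits`
  (the correct idele topology). Mathlib has no idelic norm; we define it (`ideleNorm`) as the
  product of the normalised local absolute values, using `finprod` at the finite places, and
  the principal ideles (`principalUnits`) as the range of `Units.map (algebraMap K 𝔸_K)`.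
  To keep all definitions `sorry`-free we do not bundle `ideleNorm` as a monoid homomorphism;
  the norm-one idele class group is expressed as the image of the norm-one ideles in the
  idele class group `𝔸_Kˣ ⧸ Kˣ`, and its compactness as `IsCompact` of that image.
-/

noncomputable section

open scoped MatrixGroups

namespace Literature.NumberTheory.Automorphic

/-! ## lang.S33: modularity of elliptic curves over `ℚ` -/

section Modularity

open CongruenceSubgroup UpperHalfPlane

/-- The number of `𝔽_p`-points (including the point at infinity) of the reduction modulo the
prime `p` of an integral Weierstrass model `E : WeierstrassCurve ℤ`, i.e.
`#E(𝔽_p) = Nat.card` of the points of `E.map (Int.castRingHom (ZMod p))`. This is the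
quantity `#E(𝔽_p)` in `a_p(E) = p + 1 - #E(𝔽_p)` (Silverman, *The Arithmetic of Elliptic Curves*,
V.2; Breuil–Conrad–Diamond–Taylor 2001, Introduction). For `p ∣ Δ_E` the curve mod `p` is
singular and the value is still the (finite) number of points of the Weierstrass cubic. [cite: BreuilConradDiamondTaylor2001, Introduction] -/
def numPointsMod (E : WeierstrassCurve ℤ) (p : ℕ) : ℕ :=
  Nat.card (E.map (Int.castRingHom (ZMod p))).toAffine.Point

/-- The trace of Frobenius `a_p(E) = p + 1 - #E(𝔽_p)` of an integral Weierstrass model at a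
prime `p` (Silverman, *The Arithmetic of Elliptic Curves*, V.2). [folklore] -/
def frobeniusTrace (E : WeierstrassCurve ℤ) (p : ℕ) : ℤ :=
  (p : ℤ) + 1 - (numPointsMod E p : ℤ)

/-- **lang.S33** (modularity of elliptic curves over `ℚ`, weak `a_p`-matching form; Wiles,
*Ann. Math.* 141 (1995); Taylor–Wiles, *Ann. Math.* 141 (1995); Breuil–Conrad–Diamond–Taylor,
*JAMS* 14 (2001), Thm A). For every elliptic curve `E/ℚ`, given by an integral Weierstrass
model with nonzero discriminant `Δ_E`, there are a level `N ≥ 1` and a cusp form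
`f ∈ S₂(Γ₀(N))` whose `q`-expansion coefficients satisfy `a_p(f) = p + 1 - #E(𝔽_p)` for every
prime `p` not dividing `N Δ_E`. (Hence the Hasse–Weil conjecture for genus-one curves
over `ℚ`.) [cite: BCDTJAMS2001, Theorem A] -/
def exists_cuspForm_coeff_eq_frobeniusTrace : Prop :=
  ∀ (E : WeierstrassCurve ℤ) (hE : E.Δ ≠ 0),
    ∃ N : ℕ, 0 < N ∧ ∃ f : CuspForm (Gamma0 N) 2, ∀ p : ℕ, p.Prime → ¬ (p : ℤ) ∣ N * E.Δ →
      (qExpansion 1 ⇑f).coeff p = (frobeniusTrace E p : ℂ)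

/-- **lang.S33** (variant: full `L`-series matching; Breuil–Conrad–Diamond–Taylor, *JAMS* 14
(2001), Thm A, combined with Carayol's theorem and Atkin–Lehner theory). For every elliptic
curve `E/ℚ` there are a level `N ≥ 1` and a cusp form `f ∈ S₂(Γ₀(N))` (the newform of level
equal to the conductor) whose `q`-expansion is `∑ a_n(E) qⁿ`, where `a_n(E)` are the
coefficients of the Hasse–Weil `L`-function `L(E, s) = ∑ a_n(E) n^{-s}` of `E`
(Mathlib's `WeierstrassCurve.LFunction`, defined via minimal models at every prime). [cite: BCDTJAMS2001, Theorem A (with Carayol and Atkin–Lehner)] -/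
def exists_cuspForm_qExpansion_coeff_eq_lFunction : Prop :=
  ∀ (E : WeierstrassCurve ℚ) [E.IsElliptic],
    ∃ N : ℕ, 0 < N ∧ ∃ f : CuspForm (Gamma0 N) 2, ∀ n : ℕ,
      (qExpansion 1 ⇑f).coeff n = (E.LFunction n : ℂ)

end Modularity

/-! ## lang.S38: topology of the adele ring and compactness of the norm-one idele class group -/

section Adeles

open NumberField IsDedekindDomain

variable (K : Type*) [Field K] [NumberField K]

/-- **lang.S38** (part 1: local compactness; Cassels–Fröhlich, *Algebraic Number Theory*,
Ch. II §14; Weil, *Basic Number Theory*, IV §1). The adele ring `𝔸_K` of a number field `K`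
is a locally compact topological ring. (Stated as a theorem rather than an instance since
the proof is not in Mathlib.) [cite: CasselsFrohlichANT1967, Ch. II §14] -/
def LangWave0.locallyCompactSpace_adeleRing : Prop :=
  LocallyCompactSpace (AdeleRing (𝓞 K) K)

/-- **lang.S38** (part 2: discreteness; Cassels–Fröhlich, *Algebraic Number Theory*, Ch. II §14,
Theorem; Weil, *Basic Number Theory*, IV §2 Thm 2). The principal adeles `K ⊆ 𝔸_K` form a
discrete subgroup. [cite: CasselsFrohlichANT1967, Ch. II §14 Theorem] -/
def discreteTopology_principalSubgroup : Prop :=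
  DiscreteTopology (AdeleRing.principalSubgroup (𝓞 K) K)

/-- **lang.S38** (part 3: cocompactness; Cassels–Fröhlich, *Algebraic Number Theory*, Ch. II §14,
Theorem; Weil, *Basic Number Theory*, IV §2 Thm 2). The quotient `𝔸_K / K` of the adele ring
by the principal adeles is compact. [cite: CasselsFrohlichANT1967, Ch. II §14 Theorem] -/
def compactSpace_adeleRing_quotient_principalSubgroup : Prop :=
  CompactSpace (AdeleRing (𝓞 K) K ⧸ AdeleRing.principalSubgroup (𝓞 K) K)

/-- The idelic norm `‖x‖_𝔸 = ∏_v ‖x_v‖_v` of an idele `x ∈ 𝔸_Kˣ`, the product of the normalised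
absolute values at all places: at an infinite place `w` the factor is `‖x_w‖ ^ mult w`
(`mult w = 1` for real and `2` for complex places), at a finite place `v` it is the
`v`-adic absolute value `‖x_v‖_v = Nv ^ (-ord_v x_v)` (Mathlib's norm on
`v.adicCompletion K`). The product over the finite places is a `finprod`; it is a genuine finite
product since an idele is a unit at all but finitely many `v` (Cassels–Fröhlich, *Algebraic
Number Theory*, Ch. II §16; Weil, *Basic Number Theory*, IV §4). [folklore] -/
def LangWave0.ideleNorm (x : (AdeleRing (𝓞 K) K)ˣ) : ℝ :=
  (∏ w : InfinitePlace K, ‖(x : AdeleRing (𝓞 K) K).1 w‖ ^ w.mult) *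
    ∏ᶠ v : HeightOneSpectrum (𝓞 K), ‖(x : AdeleRing (𝓞 K) K).2 v‖

/-- The subgroup of principal ideles `Kˣ ⊆ 𝔸_Kˣ`, the image of `Kˣ` under the diagonal
embedding (Cassels–Fröhlich, *Algebraic Number Theory*, Ch. II §16). [folklore] -/
def principalUnits : Subgroup (AdeleRing (𝓞 K) K)ˣ :=
  (Units.map (algebraMap K (AdeleRing (𝓞 K) K) : K →* AdeleRing (𝓞 K) K)).range

/-- The idele class group `C_K = 𝔸_Kˣ / Kˣ` of a number field, with the quotient of the idele
topology (Cassels–Fröhlich, *Algebraic Number Theory*, Ch. II §16; Weil, *Basic Number Theory*,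
IV §4). [folklore] -/
abbrev LangWave0.IdeleClassGroup : Type _ :=
  (AdeleRing (𝓞 K) K)ˣ ⧸ principalUnits K

/-- The norm-one idele class group `C_K¹ = 𝔸_Kˣ,¹ / Kˣ`, as the image in `C_K` of the ideles of
idelic norm one (this contains `Kˣ` by the product formula) (Cassels–Fröhlich, *Algebraic
Number Theory*, Ch. II §16). [folklore] -/
def normOneIdeleClasses : Set (LangWave0.IdeleClassGroup K) :=
  QuotientGroup.mk '' {x : (AdeleRing (𝓞 K) K)ˣ | LangWave0.ideleNorm K x = 1}

/-- **lang.S38** (part 4: compactness of the norm-one idele class group; Cassels–Fröhlich,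
*Algebraic Number Theory*, Ch. II §16 Theorem, §17; Weil, *Basic Number Theory*, IV §4 Thm 6).
The norm-one idele class group `𝔸_Kˣ,¹ / Kˣ` is compact (equivalent to finiteness of the class
number together with Dirichlet's unit theorem). [cite: CasselsFrohlichANT1967, Ch. II §16 Theorem and §17] -/
def isCompact_normOneIdeleClasses : Prop :=
  IsCompact (normOneIdeleClasses K)

end Adeles

end Literature.NumberTheory.Automorphic
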